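import Literature.AlgebraicGeometry.Morphisms.ProjectiveMorphism
import Literature.AlgebraicGeometry.Morphisms.GraphFamilyBaseChange
import Literature.AlgebraicGeometry.Morphisms.SigmaDescSeparated
import Literature.AlgebraicGeometry.Morphisms.ClopenPieceOfCoproduct
import Literature.AlgebraicGeometry.Motives.HilbertImageInGrassmannianUniversalFamily
import Mathlib.Topology.LocallyConstant.Basic
import HarnessLib

/-!
# Gluing the Hom-scheme from its Hilbert-polynomial pieces: `Hom_S(Y, X) = ∐_Q Hom^Q_S(Y, X)`

Layer `Literature/AlgebraicGeometry/Morphisms`, namespace `Literature.AlgebraicGeometry.Morphisms` (bricks §2–§3 in the sub-namespace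
`HomScheme`).  Theorems only: no definition, no named fact, no instance, no notation, no `sorry`.

The last step of the construction of the Hom-scheme of two projective `S`-schemes ([MumfordFogartyKirwan1994] Ch. 0 §5 (c),
p. 23; Grothendieck, FGA no. 221 §4.c): `Hom_S(Y, X)` is the DISJOINT UNION over the Hilbert polynomials `Q` of the graph of the
pieces `Hom^Q_S(Y, X)` (each an open-of-closed subscheme of `Hilb^Q(Y ×_S X ∕ S)`).  Model of record (cell hodgecm-mathlib, II-b child
line `F4IIbHomScheme`, B-p14 (g20) skeleton): `q : Y → S` flat, `p : X → S`, a closed `S`-embedding `jW : Y ×_S X ↪ 𝐏(ι; S)` (★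
`Morphisms.projectiveSpace`); a `T`-morphism is `φ : Y_T → X_T` over `T` (`Y_T = pullback q v`); its GRAPH FAMILY is the unique
`iΓ : Y_T ↪ 𝐏(ι; T)` with `iΓ ≫ pr_T = pr_T` and `iΓ ≫ 𝐏(v) = (pr_Y, φ ≫ pr_X) ≫ jW` (★ `Morphisms/GraphFamilyBaseChange`); the LETTERS
of cohomology-and-base-change with a polynomial `Q` at a field point `x : Spec K → T` are `Ext¹(𝒪_{X₀}, k^*𝒪_Γ(e)) = 0` and
`dim_K Γ(X₀, k^*𝒪_Γ(e)) = Q(e)` for `e ≥ B(Q) − 1` (★ `SerreTwist.twistMod`, ★ `Modules.SecMod`, Mumford's bound ★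
`LaurentCech.regularityBound`); admissible `Q` = those with `⌊Q(e)⌋₊ = Q(e)` beyond the bound.

* §1 `nonempty_isColimit_cofanMk_pullbackMap`, `nonempty_isColimit_cofanMk_fiber` — a disjoint-union decomposition `T = ∐ T_i`
  (a colimit cofan; its legs are open immersions with disjoint covering images, ★ `ClopenPieceOfCoproduct`) pulls back to
  `Y ×_S T = ∐ Y ×_S T_i`, and the level sets of a locally constant function decompose a scheme (Mathlib
  `nonempty_isColimit_cofanMk_of`).
* §2 `HomScheme.exists_restrict`, `HomScheme.map_comp_map_eq_map_comp_map` — restriction of a `T`-morphism along `T' → T` and the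
  composition bookkeeping of Mathlib's `pullback.map`.
* §3 `HomScheme.exists_restrict_eq_of_lift` — the equation `φ = w^*u` descends to a summand `M_Q ↪ M` through which `w` factors
  (cancel the monomorphism `X_{M_Q} ↪ X_M`).
* §4 **`exists_homScheme_of_pieces`** — THE GLUING, in the letters of the line's sub-letter (D) `stub_IIb4D_gluing` VERBATIM: given
  the pieces `(M_Q, m_Q, u_Q)` with SELF (the graph family of `u_Q` has the letters `Q`) and UNIV (universal among `(T, v, φ)` with
  the letters `Q`) for every admissible `Q`, and the DECOMPOSITION (every `(T, v, φ)` has a locally constant admissible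
  `P : T → ℚ[X]` with the letters `P t` at the field points through `t`), the `S`-scheme `M := ∐_Q M_Q` (locally Noetherian,
  separated, locally of finite type: ★ `Morphisms/SigmaDescSeparated`) with `u` glued from the `u_Q` represents all `T`-morphisms
  `Y_T → X_T`, `T` locally Noetherian: `∃! w : T → M` over `S` with `φ = w^*u`.  Existence: glue the `w_Q : {P = Q} → M_Q` of UNIV
  over `T = ∐_Q {P = Q}`.  Uniqueness: a second `w'` maps `{P = Q}` into the summand `M_Q`, because at a point `t` with
  `w'(t) ∈ M_{Q'}` the graph family has the letters `Q'` (SELF, transported along the base change by ★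
  `isPullback_map_graphFamily` ∕ `letters_of_isPullback_projectiveSpaceMap`) and `P t` (DECOMPOSITION), so `Q'` and `P t` agree at
  all large integers and are equal (Mathlib `Polynomial.eq_of_infinite_eval_eq`); then UNIV on each piece.

Cell hodgecm-mathlib, crux `HDel` (stmt-HodgeConjecture-24835), F-4 (II-b), F0P1a-p01 (g0).  Count-neutral capital: HC_CM is proved
only modulo the 7 printed citations until rung 0 closes; nothing here bears on it.

## References

* D. Mumford, J. Fogarty, F. Kirwan, *Geometric Invariant Theory*, 3rd ed. (1994), Ch. 0 §5 (c), p. 23. [MumfordFogartyKirwan1994]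
* U. Görtz, T. Wedhorn, *Algebraic Geometry I: Schemes*, 2nd ed. (2020), §(3.5) Prop. 3.10 and Example 3.11 (p. 73).
  [GortzWedhorn2020]
* The Stacks Project, Tags 01JB, 01JO. [StacksProject]
-/

noncomputable section

set_option backward.isDefEq.respectTransparency false

open CategoryTheory CategoryTheory.Limits CategoryTheory.Abelian AlgebraicGeometry TopologicalSpace Polynomial
open Literature.AlgebraicGeometry
open Literature.AlgebraicGeometry.Morphisms (IsProjective)
open Literature.AlgebraicGeometry.Modules Literature.AlgebraicGeometry.Modules.SerreTwist
open Literature.Algebra.Homology Literature.Algebra.Homology.LaurentCech Literature.Algebra.Homology.OrderedCech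

namespace Literature.AlgebraicGeometry.Morphisms

universe u

/-! ## §1 Pulling back a disjoint-union decomposition -/

section Cofan

variable {σ : Type u} {T : Scheme.{u}} {Tp : σ → Scheme.{u}} (f : ∀ i, Tp i ⟶ T)

/-- **The pullback of a coproduct decomposition is a coproduct decomposition**: if `(f i : T_i ⟶ T)` is a colimit cofan of
schemes (so `T = ∐ T_i`), then for `q : Y → S`, `v : T → S` the base changes `Y ×_S T_i ⟶ Y ×_S T` form a colimit cofan
(the legs are open immersions with pairwise disjoint covering images, Mathlib `nonempty_isColimit_cofanMk_of`).
[cite: GortzWedhorn2020, §(3.5) Proposition 3.10 and Example 3.11 (disjoint union of schemes, p. 73)] [cite: StacksProject, Tag 01JB] -/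
theorem nonempty_isColimit_cofanMk_pullbackMap (hc : IsColimit (Cofan.mk T f)) {S Y : Scheme.{u}} (q : Y ⟶ S) (v : T ⟶ S)
    (v_ : ∀ i, Tp i ⟶ S) (hv : ∀ i, f i ≫ v = v_ i) :
    Nonempty (IsColimit (Cofan.mk (pullback q v) fun i =>
      pullback.map q (v_ i) q v (𝟙 Y) (f i) (𝟙 S) (by simp) (by simpa using (hv i).symm))) := by
  haveI : ∀ i, IsOpenImmersion (f i) := isOpenImmersion_of_isColimit_cofan hc
  refine nonempty_isColimit_cofanMk_of _ ?_ ?_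
  · refine top_le_iff.mp fun z _ => ?_
    rw [Opens.mem_iSup]
    obtain ⟨i, y, hy⟩ := exists_eq_of_isColimit_cofan hc ((pullback.snd q v).base z)
    refine ⟨i, ?_⟩
    change z ∈ Set.range _
    rw [Scheme.Pullback.range_map]
    exact ⟨⟨(pullback.fst q v).base z, by simp⟩, ⟨y, hy⟩⟩
  · intro i j hij
    change Disjoint _ _
    rw [← Opens.coe_disjoint, Scheme.Hom.coe_opensRange, Scheme.Hom.coe_opensRange, Scheme.Pullback.range_map,
      Scheme.Pullback.range_map]
    exact Disjoint.mono Set.inter_subset_right Set.inter_subset_right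
      ((pairwise_disjoint_range_of_isColimit_cofan hc hij).preimage _)

/-- The level sets of a locally constant function `P : T → σ` on a scheme decompose `T` as the disjoint union of the open
subschemes `{P = Q}` (a colimit cofan of the inclusions). [cite: StacksProject, Tag 01JB] -/
theorem nonempty_isColimit_cofanMk_fiber {T : Scheme.{u}} {σ : Type u} {P : ↥T → σ} (hP : IsLocallyConstant P) :
    Nonempty (IsColimit (Cofan.mk T fun Q : σ =>
      Scheme.Opens.ι (⟨{t | P t = Q}, hP.isOpen_fiber Q⟩ : T.Opens))) := by
  refine nonempty_isColimit_cofanMk_of _ ?_ ?_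
  · refine top_le_iff.mp fun t _ => ?_
    rw [Opens.mem_iSup]
    exact ⟨P t, by rw [Scheme.Opens.opensRange_ι]; rfl⟩
  · intro Q Q' hQ
    simp only [Function.onFun, Scheme.Opens.opensRange_ι]
    rw [← Opens.coe_disjoint, Set.disjoint_iff]
    rintro t ⟨h₁, h₂⟩
    exact hQ ((show P t = Q from h₁).symm.trans (show P t = Q' from h₂))

end Cofan

/-! ## §2 Restricting a `T`-morphism `φ : Y_T → X_T` along `a : T' → T`, and compositions of base-change maps -/

namespace HomScheme

section Restrict

variable {S Y X : Scheme.{u}} (q : Y ⟶ S) (p : X ⟶ S)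

/-- **Restriction of a `T`-morphism along `a : T' → T`**: there is a `T'`-morphism `φ' : Y_{T'} → X_{T'}` whose composite with
`X_{T'} → X_T` is `Y_{T'} → Y_T ≫ φ` (the base change `φ ×_T T'`). [cite: StacksProject, Tag 01JO] -/
theorem exists_restrict {T T' : Scheme.{u}} (v : T ⟶ S) (φ : pullback q v ⟶ pullback p v)
    (hφ : φ ≫ pullback.snd p v = pullback.snd q v) (a : T' ⟶ T) (v' : T' ⟶ S) (hv' : a ≫ v = v') :
    ∃ φ' : pullback q v' ⟶ pullback p v', φ' ≫ pullback.snd p v' = pullback.snd q v' ∧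
      φ' ≫ pullback.map p v' p v (𝟙 X) a (𝟙 S) (by simp) (by simpa using hv'.symm) =
        pullback.map q v' q v (𝟙 Y) a (𝟙 S) (by simp) (by simpa using hv'.symm) ≫ φ := by
  refine ⟨pullback.lift (pullback.map q v' q v (𝟙 Y) a (𝟙 S) (by simp) (by simpa using hv'.symm) ≫ φ ≫ pullback.fst p v)
    (pullback.snd q v') ?_, pullback.lift_snd _ _ _, ?_⟩
  · rw [Category.assoc, Category.assoc, pullback.condition, ← Category.assoc φ, hφ, ← Category.assoc, pullback.lift_snd,
      Category.assoc, hv']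
  · apply pullback.hom_ext
    · simp only [Category.assoc, pullback.lift_fst, Category.comp_id]
    · simp only [Category.assoc, pullback.lift_snd, pullback.lift_snd_assoc, hφ]

/-- Base-change maps compose: `(Y_{T'} → Y_T) ≫ (Y_T → Y_M) = (Y_{T'} → Y_{M'}) ≫ (Y_{M'} → Y_M)` whenever the square of bases
`T' → T → M`, `T' → M' → M` commutes. [cite: StacksProject, Tag 01JO] -/
theorem map_comp_map_eq_map_comp_map {T T' M M' : Scheme.{u}} (v : T ⟶ S) (v' : T' ⟶ S) (m : M ⟶ S) (m' : M' ⟶ S)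
    (a : T' ⟶ T) (hv' : a ≫ v = v') (w : T ⟶ M) (hw : w ≫ m = v) (w' : T' ⟶ M') (hw' : w' ≫ m' = v')
    (b : M' ⟶ M) (hb : b ≫ m = m') (h : w' ≫ b = a ≫ w) :
    pullback.map q v' q v (𝟙 Y) a (𝟙 S) (by simp) (by simpa using hv'.symm) ≫
        pullback.map q v q m (𝟙 Y) w (𝟙 S) (by simp) (by simpa using hw.symm) =
      pullback.map q v' q m' (𝟙 Y) w' (𝟙 S) (by simp) (by simpa using hw'.symm) ≫
        pullback.map q m' q m (𝟙 Y) b (𝟙 S) (by simp) (by simpa using hb.symm) := by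
  apply pullback.hom_ext
  · simp only [Category.assoc, pullback.lift_fst, Category.comp_id]
  · simp only [Category.assoc, pullback.lift_snd, pullback.lift_snd_assoc, h]

end Restrict

/-! ## §3 The defining equation of the Hom-functor descends to a summand -/

section Pieces

variable {S Y X : Scheme.{u}} (q : Y ⟶ S) (p : X ⟶ S)

/-- **The equation `φ = w^*u` descends to a summand.**  Let `ιQ : M_Q ↪ M` be an open immersion over `S`, `u` a morphism
`Y_M → X_M` restricting to `u_Q` on `Y_{M_Q}`, `φ : Y_T → X_T` with `φ = w^*u` for `w : T → M`, and `a : T' → T` with `a ≫ w`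
factoring as `wa ≫ ιQ`; then the restriction `φ'` of `φ` to `T'` is `wa^*u_Q` (cancel the monomorphism `X_{M_Q} ↪ X_M`).
[cite: MumfordFogartyKirwan1994, Ch. 0 §5 (c) (p. 23)] -/
theorem exists_restrict_eq_of_lift {M MQ T T' : Scheme.{u}} (m : M ⟶ S) (mQ : MQ ⟶ S) (ιQ : MQ ⟶ M) [IsOpenImmersion ιQ]
    (hιm : ιQ ≫ m = mQ) (u : pullback q m ⟶ pullback p m) (uQ : pullback q mQ ⟶ pullback p mQ)
    (hu : pullback.map q mQ q m (𝟙 Y) ιQ (𝟙 S) (by simp) (by simpa using hιm.symm) ≫ u =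
      uQ ≫ pullback.map p mQ p m (𝟙 X) ιQ (𝟙 S) (by simp) (by simpa using hιm.symm))
    (v : T ⟶ S) (φ : pullback q v ⟶ pullback p v) (w : T ⟶ M) (hw : w ≫ m = v)
    (heq : φ ≫ pullback.map p v p m (𝟙 X) w (𝟙 S) (by simp) (by simpa using hw.symm) =
      pullback.map q v q m (𝟙 Y) w (𝟙 S) (by simp) (by simpa using hw.symm) ≫ u)
    (a : T' ⟶ T) (v' : T' ⟶ S) (hv' : a ≫ v = v') (φ' : pullback q v' ⟶ pullback p v')
    (hcomp : φ' ≫ pullback.map p v' p v (𝟙 X) a (𝟙 S) (by simp) (by simpa using hv'.symm) =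
      pullback.map q v' q v (𝟙 Y) a (𝟙 S) (by simp) (by simpa using hv'.symm) ≫ φ)
    (wa : T' ⟶ MQ) (hwa : wa ≫ ιQ = a ≫ w) :
    ∃ hw' : wa ≫ mQ = v',
      φ' ≫ pullback.map p v' p mQ (𝟙 X) wa (𝟙 S) (by simp) (by simpa using hw'.symm) =
        pullback.map q v' q mQ (𝟙 Y) wa (𝟙 S) (by simp) (by simpa using hw'.symm) ≫ uQ := by
  have hw' : wa ≫ mQ = v' := by rw [← hιm, ← Category.assoc, hwa, Category.assoc, hw, hv']
  refine ⟨hw', ?_⟩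
  rw [← cancel_mono (pullback.map p mQ p m (𝟙 X) ιQ (𝟙 S) (by simp) (by simpa using hιm.symm)), Category.assoc,
    Category.assoc, ← map_comp_map_eq_map_comp_map p v v' m mQ a hv' w hw wa hw' ιQ hιm hwa, ← Category.assoc, hcomp,
    Category.assoc, heq, ← Category.assoc, map_comp_map_eq_map_comp_map q v v' m mQ a hv' w hw wa hw' ιQ hιm hwa,
    Category.assoc, hu]

end Pieces

end HomScheme

/-! ## §4 The gluing: `Hom_S(Y, X) = ∐_Q Hom^Q_S(Y, X)` -/

section Gluing

/-- **(D) GLUING — the Hom-scheme from its Hilbert-polynomial pieces** ([MumfordFogartyKirwan1994] Ch. 0 §5 (c); [FGA] 221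
§4.c).  Fix a closed `S`-embedding `jW : Y ×_S X ↪ 𝐏(ι; S)`.  Suppose that for every admissible polynomial `Q` an `S`-scheme
`m_Q : M_Q → S` (locally Noetherian, separated, locally of finite type) with an `M_Q`-morphism `u_Q : Y_{M_Q} → X_{M_Q}` is given
whose graph family has the letters `Q` at every field point (SELF) and which is universal among the `(T, v, φ)` whose graph family
has the letters `Q` (UNIV), and suppose every `(T, v, φ)` admits a locally constant admissible `P : T → ℚ[X]` with the letters `P t`
at the field points through `t` (DECOMPOSITION).  Then `M := ∐_Q M_Q → S` with `u` glued from the `u_Q` represents ALL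
`T`-morphisms `Y_T → X_T` (`T` locally Noetherian): `M` is the disjoint union (Mathlib `∐`, separated ∕ l.f.t. ∕ locally Noetherian
summand by summand), `u` is defined on the summands `Y_{M_Q}` of `Y_M = ∐_Q Y_{M_Q}`, a given `φ` is `w^*u` for the `w` glued from
the `w_Q : {P = Q} → M_Q` of UNIV over the clopen level sets of `P`, and `w` is unique because a second `w'` sends `{P = Q}` into the
summand `M_Q` — at a point `t` with `w'(t) ∈ M_{Q'}` the graph family has both the letters `Q'` (SELF transported) and `P t`, so the
polynomials `Q'` and `P t` agree at all large integers and coincide. [cite: MumfordFogartyKirwan1994, Ch. 0 §5 (c) (p. 23)] -/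
theorem exists_homScheme_of_pieces : ∀ ⦃S Y X : Scheme.{0}⦄ [IsLocallyNoetherian S] (q : Y ⟶ S) (p : X ⟶ S) [Flat q]
    (_ : IsProjective q) (_ : IsProjective p) {ι : Type} (_ : 1 ≤ Nat.card ι)
    (jW : pullback q p ⟶ Morphisms.projectiveSpace ι S) [IsClosedImmersion jW]
    (_ : jW ≫ Morphisms.projectiveSpaceFst ι S = pullback.fst q p ≫ q)
    -- the pieces, indexed by the admissible polynomials
    (M_ : {Q : ℚ[X] // ∀ e : ℕ, regularityBound (preHilbertPoly ℚ (Nat.card ι) 0) 0 (preHilbertPoly ℚ (Nat.card ι) 0 - Q) - 1 ≤ (e : ℤ) →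
      ((⌊Q.eval (e : ℚ)⌋₊ : ℕ) : ℚ) = Q.eval (e : ℚ)} → Scheme.{0})
    (m_ : ∀ Q, M_ Q ⟶ S) (_ : ∀ Q, IsLocallyNoetherian (M_ Q)) (_ : ∀ Q, IsSeparated (m_ Q)) (_ : ∀ Q, LocallyOfFiniteType (m_ Q))
    (u_ : ∀ Q, pullback q (m_ Q) ⟶ pullback p (m_ Q)) (_ : ∀ Q, u_ Q ≫ pullback.snd p (m_ Q) = pullback.snd q (m_ Q))
    (_ : ∀ Q, (∀ (hw : pullback.fst q (m_ Q) ≫ q = (u_ Q ≫ pullback.fst p (m_ Q)) ≫ p)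
        (iΓ : pullback q (m_ Q) ⟶ Morphisms.projectiveSpace ι (M_ Q)),
        iΓ ≫ Morphisms.projectiveSpaceFst ι (M_ Q) = pullback.snd q (m_ Q) →
        iΓ ≫ Morphisms.projectiveSpaceMap ι (m_ Q) = pullback.lift (pullback.fst q (m_ Q)) (u_ Q ≫ pullback.fst p (m_ Q)) hw ≫ jW →
        ∀ ⦃K : Type⦄ [Field K] ⦃X₀ : Scheme.{0}⦄ (k : X₀ ⟶ pullback q (m_ Q)) (f₀ : X₀ ⟶ Spec (CommRingCat.of K))
          (x : Spec (CommRingCat.of K) ⟶ M_ Q), IsPullback k f₀ (iΓ ≫ Morphisms.projectiveSpaceFst ι (M_ Q)) x →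
          ∀ e : ℕ, regularityBound (preHilbertPoly ℚ (Nat.card ι) 0) 0 (preHilbertPoly ℚ (Nat.card ι) 0 - Q.1) - 1 ≤ (e : ℤ) →
            Subsingleton (CategoryTheory.Abelian.Ext.{1} (unitModule X₀) ((Scheme.Modules.pullback k).obj
              (twistMod (iΓ ≫ pullback.snd (terminal.from (M_ Q)) (terminal.from (Morphisms.projectiveSpaceInt ι))) (unitModule _) e)) 1) ∧
            ((Module.finrank Γ(Spec (CommRingCat.of K), ⊤) (SecMod ((Scheme.Modules.pullback k).obj
              (twistMod (iΓ ≫ pullback.snd (terminal.from (M_ Q)) (terminal.from (Morphisms.projectiveSpaceInt ι))) (unitModule _) e))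
              f₀.appTop.hom ⊤) : ℕ) : ℚ) = Q.1.eval (e : ℚ)) ∧
      ∀ ⦃T : Scheme.{0}⦄ [IsLocallyNoetherian T] (v : T ⟶ S) (φ : pullback q v ⟶ pullback p v)
        (hφ : φ ≫ pullback.snd p v = pullback.snd q v),
        (∀ (hw : pullback.fst q v ≫ q = (φ ≫ pullback.fst p v) ≫ p) (iΓ : pullback q v ⟶ Morphisms.projectiveSpace ι T),
          iΓ ≫ Morphisms.projectiveSpaceFst ι T = pullback.snd q v →
          iΓ ≫ Morphisms.projectiveSpaceMap ι v = pullback.lift (pullback.fst q v) (φ ≫ pullback.fst p v) hw ≫ jW →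
          ∀ ⦃K : Type⦄ [Field K] ⦃X₀ : Scheme.{0}⦄ (k : X₀ ⟶ pullback q v) (f₀ : X₀ ⟶ Spec (CommRingCat.of K))
            (x : Spec (CommRingCat.of K) ⟶ T), IsPullback k f₀ (iΓ ≫ Morphisms.projectiveSpaceFst ι T) x →
            ∀ e : ℕ, regularityBound (preHilbertPoly ℚ (Nat.card ι) 0) 0 (preHilbertPoly ℚ (Nat.card ι) 0 - Q.1) - 1 ≤ (e : ℤ) →
              Subsingleton (CategoryTheory.Abelian.Ext.{1} (unitModule X₀) ((Scheme.Modules.pullback k).obj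
                (twistMod (iΓ ≫ pullback.snd (terminal.from T) (terminal.from (Morphisms.projectiveSpaceInt ι))) (unitModule _) e)) 1) ∧
              ((Module.finrank Γ(Spec (CommRingCat.of K), ⊤) (SecMod ((Scheme.Modules.pullback k).obj
                (twistMod (iΓ ≫ pullback.snd (terminal.from T) (terminal.from (Morphisms.projectiveSpaceInt ι))) (unitModule _) e))
                f₀.appTop.hom ⊤) : ℕ) : ℚ) = Q.1.eval (e : ℚ)) →
        ∃! w : T ⟶ M_ Q, ∃ (hw : w ≫ m_ Q = v),
          φ ≫ pullback.map p v p (m_ Q) (𝟙 X) w (𝟙 S) (by simp) (by simpa using hw.symm) =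
            pullback.map q v q (m_ Q) (𝟙 Y) w (𝟙 S) (by simp) (by simpa using hw.symm) ≫ u_ Q)
    -- the decomposition (C) of every test morphism
    (_ : ∀ ⦃T : Scheme.{0}⦄ [IsLocallyNoetherian T] (v : T ⟶ S) (φ : pullback q v ⟶ pullback p v)
      (_ : φ ≫ pullback.snd p v = pullback.snd q v) (hw : pullback.fst q v ≫ q = (φ ≫ pullback.fst p v) ≫ p)
      (iΓ : pullback q v ⟶ Morphisms.projectiveSpace ι T), iΓ ≫ Morphisms.projectiveSpaceFst ι T = pullback.snd q v →
      iΓ ≫ Morphisms.projectiveSpaceMap ι v = pullback.lift (pullback.fst q v) (φ ≫ pullback.fst p v) hw ≫ jW →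
      ∃ P : T → ℚ[X], IsLocallyConstant P ∧
        (∀ t : T, ∀ e : ℕ, regularityBound (preHilbertPoly ℚ (Nat.card ι) 0) 0 (preHilbertPoly ℚ (Nat.card ι) 0 - P t) - 1 ≤ (e : ℤ) →
          ((⌊(P t).eval (e : ℚ)⌋₊ : ℕ) : ℚ) = (P t).eval (e : ℚ)) ∧
        ∀ ⦃K : Type⦄ [Field K] ⦃X₀ : Scheme.{0}⦄ (k : X₀ ⟶ pullback q v) (f₀ : X₀ ⟶ Spec (CommRingCat.of K))
          (x : Spec (CommRingCat.of K) ⟶ T), IsPullback k f₀ (iΓ ≫ Morphisms.projectiveSpaceFst ι T) x →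
          ∀ t : T, t ∈ Set.range x.base →
          ∀ e : ℕ, regularityBound (preHilbertPoly ℚ (Nat.card ι) 0) 0 (preHilbertPoly ℚ (Nat.card ι) 0 - P t) - 1 ≤ (e : ℤ) →
            Subsingleton (CategoryTheory.Abelian.Ext.{1} (unitModule X₀) ((Scheme.Modules.pullback k).obj
              (twistMod (iΓ ≫ pullback.snd (terminal.from T) (terminal.from (Morphisms.projectiveSpaceInt ι))) (unitModule _) e)) 1) ∧
            ((Module.finrank Γ(Spec (CommRingCat.of K), ⊤) (SecMod ((Scheme.Modules.pullback k).obj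
              (twistMod (iΓ ≫ pullback.snd (terminal.from T) (terminal.from (Morphisms.projectiveSpaceInt ι))) (unitModule _) e))
              f₀.appTop.hom ⊤) : ℕ) : ℚ) = (P t).eval (e : ℚ)),
    ∃ (M : Scheme.{0}) (m : M ⟶ S) (_ : IsLocallyNoetherian M) (_ : IsSeparated m) (_ : LocallyOfFiniteType m)
      (u : pullback q m ⟶ pullback p m) (_ : u ≫ pullback.snd p m = pullback.snd q m),
      ∀ ⦃T : Scheme.{0}⦄ [IsLocallyNoetherian T] (v : T ⟶ S) (φ : pullback q v ⟶ pullback p v)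
        (hφ : φ ≫ pullback.snd p v = pullback.snd q v),
        ∃! w : T ⟶ M, ∃ (hw : w ≫ m = v),
          φ ≫ pullback.map p v p m (𝟙 X) w (𝟙 S) (by simp) (by simpa using hw.symm) =
            pullback.map q v q m (𝟙 Y) w (𝟙 S) (by simp) (by simpa using hw.symm) ≫ u := by
  intro S Y X _ q p _ _ _ ι hn jW _ hjW M_ m_ hMn hMs hMl u_ hu_ hB hC
  /- (a) the disjoint union `M := ∐_Q M_Q → S` and the decompositions `Y_M = ∐ Y_{M_Q}`, `X_M = ∐ X_{M_Q}` -/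
  haveI : ∀ Q, IsLocallyNoetherian (M_ Q) := hMn
  haveI : ∀ Q, IsSeparated (m_ Q) := hMs
  haveI : ∀ Q, LocallyOfFiniteType (m_ Q) := hMl
  have hcM : IsColimit (Cofan.mk (∐ M_) (Sigma.ι M_)) := coproductIsCoproduct M_
  have hιm : ∀ Q, Sigma.ι M_ Q ≫ Sigma.desc m_ = m_ Q := fun Q => Sigma.ι_desc m_ Q
  haveI hιO : ∀ Q, IsOpenImmersion (Sigma.ι M_ Q) := isOpenImmersion_of_isColimit_cofan hcM
  obtain ⟨hcMq⟩ := nonempty_isColimit_cofanMk_pullbackMap (Sigma.ι M_) hcM q (Sigma.desc m_) m_ hιm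
  obtain ⟨hcMp⟩ := nonempty_isColimit_cofanMk_pullbackMap (Sigma.ι M_) hcM p (Sigma.desc m_) m_ hιm
  /- (b) the universal morphism `u`, glued from the `u_Q` on the summands `Y_{M_Q}` -/
  let u : pullback q (Sigma.desc m_) ⟶ pullback p (Sigma.desc m_) := Cofan.IsColimit.desc hcMq fun Q =>
    u_ Q ≫ pullback.map p (m_ Q) p (Sigma.desc m_) (𝟙 X) (Sigma.ι M_ Q) (𝟙 S) (by simp) (by simp)
  have hu_fac : ∀ Q, pullback.map q (m_ Q) q (Sigma.desc m_) (𝟙 Y) (Sigma.ι M_ Q) (𝟙 S) (by simp) (by simp) ≫ u =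
      u_ Q ≫ pullback.map p (m_ Q) p (Sigma.desc m_) (𝟙 X) (Sigma.ι M_ Q) (𝟙 S) (by simp) (by simp) :=
    fun Q => Cofan.IsColimit.fac hcMq _ Q
  have hu : u ≫ pullback.snd p (Sigma.desc m_) = pullback.snd q (Sigma.desc m_) := by
    refine Cofan.IsColimit.hom_ext hcMq _ _ fun Q => ?_
    rw [cofan_mk_inj, reassoc_of% (hu_fac Q)]
    simp only [pullback.lift_snd, reassoc_of% (hu_ Q)]
  haveI : IsLocallyNoetherian (∐ M_) := isLocallyNoetherian_sigma M_
  refine ⟨∐ M_, Sigma.desc m_, inferInstance, isSeparated_sigmaDesc m_, locallyOfFiniteType_sigmaDesc m_, u, hu, ?_⟩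
  intro T _ v φ hφ
  /- (c) the graph family of `φ` and its decomposition by the Hilbert polynomial (C) -/
  have hw₀ := fst_comp_eq_comp_fst_comp_of_over q p v φ hφ
  obtain ⟨iΓ₀, h₁, h₂⟩ := exists_graphFamily_of_over q p jW v φ hjW hw₀
  obtain ⟨P, hP, hadm, hlet⟩ := hC v φ hφ hw₀ iΓ₀ h₁ h₂
  -- the admissible-valued polynomial function and its (clopen) level sets `U Q`
  let P' : ↥T → {Q : ℚ[X] // ∀ e : ℕ, regularityBound (preHilbertPoly ℚ (Nat.card ι) 0) 0
      (preHilbertPoly ℚ (Nat.card ι) 0 - Q) - 1 ≤ (e : ℤ) → ((⌊Q.eval (e : ℚ)⌋₊ : ℕ) : ℚ) = Q.eval (e : ℚ)} :=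
    fun t => ⟨P t, hadm t⟩
  have hP' : IsLocallyConstant P' := by
    refine IsLocallyConstant.iff_isOpen_fiber.2 fun Q => ?_
    have hfib : P' ⁻¹' {Q} = {t | P t = Q.1} := by
      ext t
      simp only [Set.mem_preimage, Set.mem_singleton_iff, Set.mem_setOf_eq, P', Subtype.ext_iff]
    rw [hfib]
    exact hP.isOpen_fiber Q.1
  let U : {Q : ℚ[X] // ∀ e : ℕ, regularityBound (preHilbertPoly ℚ (Nat.card ι) 0) 0
      (preHilbertPoly ℚ (Nat.card ι) 0 - Q) - 1 ≤ (e : ℤ) → ((⌊Q.eval (e : ℚ)⌋₊ : ℕ) : ℚ) = Q.eval (e : ℚ)} → T.Opens :=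
    fun Q => ⟨{t | P' t = Q}, hP'.isOpen_fiber Q⟩
  have hU : ∀ Q (t : ↥T), t ∈ U Q → P t = Q.1 := fun Q t ht => congrArg Subtype.val ht
  have hcT : IsColimit (Cofan.mk T fun Q => (U Q).ι) := (nonempty_isColimit_cofanMk_fiber hP').some
  obtain ⟨hcTq⟩ := nonempty_isColimit_cofanMk_pullbackMap (fun Q => (U Q).ι) hcT q v (fun Q => (U Q).ι ≫ v) fun Q => rfl
  /- (d) the restrictions `φ_Q` of `φ` to the pieces, with the letters `Q` -/
  have hres : ∀ Q, ∃ φ' : pullback q ((U Q).ι ≫ v) ⟶ pullback p ((U Q).ι ≫ v),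
      φ' ≫ pullback.snd p ((U Q).ι ≫ v) = pullback.snd q ((U Q).ι ≫ v) ∧
      φ' ≫ pullback.map p ((U Q).ι ≫ v) p v (𝟙 X) (U Q).ι (𝟙 S) (by simp) (by simp) =
        pullback.map q ((U Q).ι ≫ v) q v (𝟙 Y) (U Q).ι (𝟙 S) (by simp) (by simp) ≫ φ :=
    fun Q => HomScheme.exists_restrict q p v φ hφ (U Q).ι _ rfl
  choose φ_ hφ_ hcomp_ using hres
  have hletQ : ∀ Q, ∀ (hw : pullback.fst q ((U Q).ι ≫ v) ≫ q = (φ_ Q ≫ pullback.fst p ((U Q).ι ≫ v)) ≫ p)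
      (iΓ : pullback q ((U Q).ι ≫ v) ⟶ Morphisms.projectiveSpace ι (U Q)),
      iΓ ≫ Morphisms.projectiveSpaceFst ι (U Q) = pullback.snd q ((U Q).ι ≫ v) →
      iΓ ≫ Morphisms.projectiveSpaceMap ι ((U Q).ι ≫ v) =
        pullback.lift (pullback.fst q ((U Q).ι ≫ v)) (φ_ Q ≫ pullback.fst p ((U Q).ι ≫ v)) hw ≫ jW →
      ∀ ⦃K : Type⦄ [Field K] ⦃X₀ : Scheme.{0}⦄ (k : X₀ ⟶ pullback q ((U Q).ι ≫ v)) (f₀ : X₀ ⟶ Spec (CommRingCat.of K))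
        (x : Spec (CommRingCat.of K) ⟶ (U Q : Scheme.{0})), IsPullback k f₀ (iΓ ≫ Morphisms.projectiveSpaceFst ι (U Q)) x →
        ∀ e : ℕ, regularityBound (preHilbertPoly ℚ (Nat.card ι) 0) 0 (preHilbertPoly ℚ (Nat.card ι) 0 - Q.1) - 1 ≤ (e : ℤ) →
          Subsingleton (CategoryTheory.Abelian.Ext.{1} (unitModule X₀) ((Scheme.Modules.pullback k).obj
            (twistMod (iΓ ≫ pullback.snd (terminal.from (U Q : Scheme.{0})) (terminal.from (Morphisms.projectiveSpaceInt ι)))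
              (unitModule _) e)) 1) ∧
          ((Module.finrank Γ(Spec (CommRingCat.of K), ⊤) (SecMod ((Scheme.Modules.pullback k).obj
            (twistMod (iΓ ≫ pullback.snd (terminal.from (U Q : Scheme.{0})) (terminal.from (Morphisms.projectiveSpaceInt ι)))
              (unitModule _) e)) f₀.appTop.hom ⊤) : ℕ) : ℚ) = Q.1.eval (e : ℚ) := by
    intro Q hw' iΓ' h₁' h₂' K _ X₀ k f₀ x H e he
    have sq := isPullback_map_graphFamily q p jW v φ hw₀ iΓ₀ h₁ h₂ (U Q).ι _ rfl (φ_ Q) hw' (hcomp_ Q) iΓ' h₁' h₂'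
    -- the point `t` of `T` under `x` lies in `U Q`, so `P t = Q`
    let t : ↥T := (x ≫ (U Q).ι).base default
    have ht : t ∈ Set.range (x ≫ (U Q).ι).base := ⟨default, rfl⟩
    have htU : t ∈ U Q := by
      change (U Q).ι.base (x.base default) ∈ U Q
      exact (x.base default).2
    have hPt : P t = Q.1 := hU Q t htU
    refine letters_of_isPullback_projectiveSpaceMap iΓ₀ (U Q).ι _ iΓ' sq k f₀ x H e _ fun k₀ H₀ => ?_
    have hl := hlet k₀ f₀ (x ≫ (U Q).ι) H₀ t ht e (by rw [hPt]; exact he)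
    rw [hPt] at hl
    exact hl
  /- (e) EXISTENCE: the `w_Q : U Q → M_Q` of UNIV, glued over `T = ∐ U Q` -/
  choose w_ hw_ huniq_ using fun Q => (hB Q).2 ((U Q).ι ≫ v) (φ_ Q) (hφ_ Q) (hletQ Q)
  have hwm_ : ∀ Q, w_ Q ≫ m_ Q = (U Q).ι ≫ v := fun Q => (hw_ Q).fst
  let w : T ⟶ ∐ M_ := Cofan.IsColimit.desc hcT fun Q => w_ Q ≫ Sigma.ι M_ Q
  have hw_fac : ∀ Q, (U Q).ι ≫ w = w_ Q ≫ Sigma.ι M_ Q := fun Q => Cofan.IsColimit.fac hcT _ Q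
  have hwm : w ≫ Sigma.desc m_ = v := by
    refine Cofan.IsColimit.hom_ext hcT _ _ fun Q => ?_
    rw [cofan_mk_inj, ← Category.assoc, hw_fac Q, Category.assoc, hιm Q, hwm_ Q]
  refine ⟨w, ⟨hwm, ?_⟩, ?_⟩
  · -- `φ = w^*u`, checked on the cover `Y_T = ∐ Y_{U Q}`
    refine Cofan.IsColimit.hom_ext hcTq _ _ fun Q => ?_
    rw [cofan_mk_inj, ← Category.assoc, ← hcomp_ Q, Category.assoc,
      HomScheme.map_comp_map_eq_map_comp_map p v ((U Q).ι ≫ v) (Sigma.desc m_) (m_ Q) (U Q).ι rfl w hwm (w_ Q) (hwm_ Q)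
        (Sigma.ι M_ Q) (hιm Q) (hw_fac Q).symm,
      ← Category.assoc, (hw_ Q).snd, Category.assoc, ← hu_fac Q, ← Category.assoc,
      ← HomScheme.map_comp_map_eq_map_comp_map q v ((U Q).ι ≫ v) (Sigma.desc m_) (m_ Q) (U Q).ι rfl w hwm (w_ Q) (hwm_ Q)
        (Sigma.ι M_ Q) (hιm Q) (hw_fac Q).symm, Category.assoc]
  /- (f) UNIQUENESS -/
  rintro w' ⟨hw'm, heq'⟩
  -- (f1) `w'` maps the piece `U Q` into the summand `M_Q`
  have hrange : ∀ Q, Set.range ((U Q).ι ≫ w').base ⊆ Set.range (Sigma.ι M_ Q).base := by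
    rintro Q _ ⟨tQ, rfl⟩
    obtain ⟨Q', y, hy⟩ := exists_eq_of_isColimit_cofan hcM (((U Q).ι ≫ w').base tQ)
    suffices hQ : Q' = Q by subst hQ; exact ⟨y, hy⟩
    -- the open `V := w'⁻¹(M_{Q'}) ∋ t` and the lift `wV : V → M_{Q'}` of `w'|_V`
    let V : T.Opens := w' ⁻¹ᵁ (Sigma.ι M_ Q').opensRange
    have htV : tQ.1 ∈ V := ⟨y, hy⟩
    have hVr : Set.range (V.ι ≫ w').base ⊆ Set.range (Sigma.ι M_ Q').base := by
      rintro _ ⟨s, rfl⟩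
      exact s.2
    obtain ⟨φV, hφV, hcompV⟩ := HomScheme.exists_restrict q p v φ hφ V.ι _ rfl
    obtain ⟨hwVm, heqV⟩ := HomScheme.exists_restrict_eq_of_lift q p (Sigma.desc m_) (m_ Q') (Sigma.ι M_ Q') (hιm Q') u (u_ Q')
      (hu_fac Q') v φ w' hw'm heq' V.ι _ rfl φV hcompV (IsOpenImmersion.lift (Sigma.ι M_ Q') (V.ι ≫ w') hVr)
      (IsOpenImmersion.lift_fac _ _ _)
    -- graph families over `V` and over `M_{Q'}`, cartesian over `𝐏(V ↪ T)` and over `𝐏(wV)`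
    have hwV' := fst_comp_eq_comp_fst_comp_of_over q p _ φV hφV
    obtain ⟨iΓV, h₁V, h₂V⟩ := exists_graphFamily_of_over q p jW _ φV hjW hwV'
    have hwQ' := fst_comp_eq_comp_fst_comp_of_over q p _ (u_ Q') (hu_ Q')
    obtain ⟨iΓQ, h₁Q, h₂Q⟩ := exists_graphFamily_of_over q p jW _ (u_ Q') hjW hwQ'
    have sqT := isPullback_map_graphFamily q p jW v φ hw₀ iΓ₀ h₁ h₂ V.ι _ rfl φV hwV' hcompV iΓV h₁V h₂V
    have sqM := isPullback_map_graphFamily q p jW (m_ Q') (u_ Q') hwQ' iΓQ h₁Q h₂Q _ _ hwVm φV hwV' heqV iΓV h₁V h₂V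
    -- the canonical field point of `V` at `t`
    let xV := (V : Scheme.{0}).fromSpecResidueField ⟨tQ.1, htV⟩
    have H := IsPullback.of_hasPullback (iΓV ≫ Morphisms.projectiveSpaceFst ι V) xV
    -- (i) the letters `Q'` there, from SELF of the piece `Q'` transported along `wV`
    have hrk₁ : ∀ e : ℕ, regularityBound (preHilbertPoly ℚ (Nat.card ι) 0) 0 (preHilbertPoly ℚ (Nat.card ι) 0 - Q'.1) - 1 ≤
        (e : ℤ) → ((Module.finrank _ (SecMod ((Scheme.Modules.pullback (pullback.fst _ _)).obj
          (twistMod (iΓV ≫ pullback.snd (terminal.from (V : Scheme.{0})) (terminal.from (Morphisms.projectiveSpaceInt ι)))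
            (unitModule _) e)) (pullback.snd (iΓV ≫ Morphisms.projectiveSpaceFst ι V) xV).appTop.hom ⊤) : ℕ) : ℚ) =
          Q'.1.eval (e : ℚ) := fun e he =>
      (letters_of_isPullback_projectiveSpaceMap iΓQ _ _ iΓV sqM (pullback.fst _ _) (pullback.snd _ _) xV H e _
        fun k₀ H₀ => (hB Q').1 hwQ' iΓQ h₁Q h₂Q k₀ _ _ H₀ e he).2
    -- (ii) the letters `P t` there, from the decomposition (C) transported along `V ↪ T`
    have ht : tQ.1 ∈ Set.range (xV ≫ V.ι).base := by
      refine ⟨IsLocalRing.closedPoint _, ?_⟩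
      change V.ι.base (xV.base (IsLocalRing.closedPoint _)) = tQ.1
      rw [Scheme.fromSpecResidueField_apply]
      rfl
    have hrk₂ : ∀ e : ℕ, regularityBound (preHilbertPoly ℚ (Nat.card ι) 0) 0 (preHilbertPoly ℚ (Nat.card ι) 0 - P tQ.1) - 1 ≤
        (e : ℤ) → ((Module.finrank _ (SecMod ((Scheme.Modules.pullback (pullback.fst _ _)).obj
          (twistMod (iΓV ≫ pullback.snd (terminal.from (V : Scheme.{0})) (terminal.from (Morphisms.projectiveSpaceInt ι)))
            (unitModule _) e)) (pullback.snd (iΓV ≫ Morphisms.projectiveSpaceFst ι V) xV).appTop.hom ⊤) : ℕ) : ℚ) =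
          (P tQ.1).eval (e : ℚ) := fun e he =>
      (letters_of_isPullback_projectiveSpaceMap iΓ₀ V.ι _ iΓV sqT (pullback.fst _ _) (pullback.snd _ _) xV H e _
        fun k₀ H₀ => hlet k₀ _ _ H₀ tQ.1 ht e he).2
    -- (iii) two polynomials agreeing at all large integers coincide
    have hPQ : Q'.1 = P tQ.1 := by
      apply Polynomial.eq_of_infinite_eval_eq
      let N : ℕ := (max (regularityBound (preHilbertPoly ℚ (Nat.card ι) 0) 0 (preHilbertPoly ℚ (Nat.card ι) 0 - Q'.1))
        (regularityBound (preHilbertPoly ℚ (Nat.card ι) 0) 0 (preHilbertPoly ℚ (Nat.card ι) 0 - P tQ.1))).toNat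
      refine Set.infinite_of_injective_forall_mem (f := fun n : ℕ => ((N + n : ℕ) : ℚ))
        (fun a b hab => by simpa using hab) fun n => ?_
      have h₁ := hrk₁ (N + n) (by omega)
      have h₂ := hrk₂ (N + n) (by omega)
      change Q'.1.eval ((N + n : ℕ) : ℚ) = (P tQ.1).eval ((N + n : ℕ) : ℚ)
      rw [← h₁, ← h₂]
    exact Subtype.ext (hPQ.trans (hU Q tQ.1 tQ.2))
  -- (f2) the lift `U Q → M_Q` of `w'|_{U Q}` satisfies UNIV for `φ_Q`, hence equals `w_Q`
  refine Cofan.IsColimit.hom_ext hcT _ _ fun Q => ?_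
  rw [cofan_mk_inj, hw_fac Q]
  obtain ⟨hw'Q, heqQ⟩ := HomScheme.exists_restrict_eq_of_lift q p (Sigma.desc m_) (m_ Q) (Sigma.ι M_ Q) (hιm Q) u (u_ Q)
    (hu_fac Q) v φ w' hw'm heq' (U Q).ι _ rfl (φ_ Q) (hcomp_ Q) (IsOpenImmersion.lift (Sigma.ι M_ Q) ((U Q).ι ≫ w') (hrange Q))
    (IsOpenImmersion.lift_fac _ _ _)
  rw [← IsOpenImmersion.lift_fac (Sigma.ι M_ Q) ((U Q).ι ≫ w') (hrange Q), huniq_ Q _ ⟨hw'Q, heqQ⟩]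

end Gluing




end Literature.AlgebraicGeometry.Morphisms

end
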